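import Summits.ResolutionOfSingularities.KangarooAtlas.MizutaniProfileTheorem
import Mathlib.RingTheory.TensorProduct.Maps
import Mathlib.RingTheory.TensorProduct.Free
import Mathlib.RingTheory.TensorProduct.Finite
import Mathlib.LinearAlgebra.FiniteDimensional.Lemmas
import Mathlib.LinearAlgebra.Dual.Defs
import HarnessLib

/-!
# Mizutani's conjecture `m(e) = 2p^e − 1` — tensor rank and LEMMA 1.5 (`rank ≥ σ_{q−1} + 1`)

Cell topic `Summits/ResolutionOfSingularities/KangarooAtlas` (pub-rosobs); namespace
`Summit.ResolutionOfSingularities.KangarooAtlas.Mizutani`.  Part of the Lean transcription of the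
in-house note MIZUTANI-PROOF-g59 (AI-written, AI-audited; *AI review is weaker than expert review*; not a
resolution theorem).  MIZUTANI-PROOF-g59 §1.3 (rank and supports) and LEMMA 1.5, in an abstract form:

* `rightSupport ω` — the right support `H_R(ω) ⊆ k` of `ω ∈ k ⊗_L k` (the span of the contractions
  `(φ ⊗ 1) ω`, `φ ∈ Hom_L(k, L)`), `tensorRank ω = dim_L H_R(ω)` (the tensor rank; §1.3),
  `mem_range_baseChange_rightSupport` (`ω ∈ k ⊗ H_R(ω)`), `rightSupport_le_span` (an expansion with right
  entries in `H` shows `H_R ⊆ H`, hence `rank ≤ #terms` — the inequality used in §3 (e));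
* **`eProfile_succ_le_tensorRank`** (LEMMA 1.5, abstract): for a `k`-linear "coordinate map"
  `Ω : k ⊗_L k → k[X_1..X_s]` intertwining the operators `D_T ⊗ 1` with the profile operators `E_T` and whose
  constant coefficient is the multiplication map `μ`, and `ω ≠ 0` whose coordinates `Ω ω` only involve
  monomials of degree `≥ q`:  `σ_{q−1}(Ω ω) + 1 ≤ rank ω`.  (The note: `V = span{(D⊗1)ω} ⊆ (k ⊗ H_R(ω)) ∩ J`
  has codimension `≥ 1` in `k ⊗ H_R(ω)`, whose `k`-dimension is `rank ω`.)

The tower files supply `Ω` (left `t`-coordinates) and `D` (Hasse–Schmidt operators); with `profile_theorem`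
this gives THEOREM F, `rank ≥ 2q`.

References: [Mizutani1973HironakaGroupSchemes] (Remark 2.10; in-house proof §1.3, Lemma 1.5);
[Oda1983HironakaGroupSchemeII] §1 (p. 1166).
-/

open MvPolynomial TensorProduct

namespace Summit.ResolutionOfSingularities.KangarooAtlas.Mizutani

section Rank

variable (L : Type*) {k : Type*} [Field L] [Field k] [Algebra L k]

/-- **The right support** `H_R(ω)`: the `L`-span of the left contractions `(φ ⊗ 1)ω`, `φ ∈ Hom_L(k,L)`
(MIZUTANI-PROOF-g59 §1.3). [cite: Mizutani1973HironakaGroupSchemes, Remark 2.10 (in-house proof §1.3, H_R)] -/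
noncomputable def rightSupport (ω : k ⊗[L] k) : Submodule L k :=
  Submodule.span L (Set.range fun φ : Module.Dual L k => TensorProduct.lid L k (φ.rTensor k ω))

/-- **The tensor rank** `rank(ω) = dim_L H_R(ω)` (MIZUTANI-PROOF-g59 §1.3).
[cite: Mizutani1973HironakaGroupSchemes, Remark 2.10 (in-house proof §1.3, rank)] -/
noncomputable def tensorRank (ω : k ⊗[L] k) : ℕ := Module.finrank L (rightSupport L ω)

variable {L}

/-- Contractions of a sum of pure tensors with right entries in `H` lie in `H`; hence `H_R(ω) ⊆ H`
(used as `rank(Σ_{l ≤ m} c_l ⊗ h_l) ≤ m`, MIZUTANI-PROOF-g59 §3 (e)).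
[cite: Mizutani1973HironakaGroupSchemes, Remark 2.10 (in-house proof §1.3 / §3 (e))] -/
theorem rightSupport_le_of_mem_range (ω : k ⊗[L] k) (H : Submodule L k)
    (hω : ω ∈ LinearMap.range (H.subtype.lTensor k)) : rightSupport L ω ≤ H := by
  unfold rightSupport
  rw [Submodule.span_le]
  rintro _ ⟨φ, rfl⟩
  obtain ⟨ξ, rfl⟩ := hω
  show TensorProduct.lid L k (φ.rTensor k (H.subtype.lTensor k ξ)) ∈ H
  -- `(φ ⊗ 1)(1 ⊗ ι_H)(ξ) = (1 ⊗ ι_H)((φ ⊗ 1) ξ)` lands in `H`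
  have hcomm : φ.rTensor k (H.subtype.lTensor k ξ) = H.subtype.lTensor L (φ.rTensor H ξ) := by
    rw [← LinearMap.comp_apply, ← LinearMap.comp_apply, LinearMap.rTensor_comp_lTensor,
      LinearMap.lTensor_comp_rTensor]
  rw [hcomm]
  induction φ.rTensor H ξ using TensorProduct.induction_on with
  | zero => simp
  | tmul l h => simpa using H.smul_mem l h.2
  | add x y hx hy => rw [map_add, map_add]; exact H.add_mem hx hy

/-- **`ω ∈ k ⊗ H_R(ω)`** (expand `ω` along an `L`-basis of `k` on the left; the right entries are contractions).
[cite: Mizutani1973HironakaGroupSchemes, Remark 2.10 (in-house proof §1.3)] -/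
theorem mem_range_baseChange_rightSupport [FiniteDimensional L k] (ω : k ⊗[L] k) :
    ω ∈ LinearMap.range ((rightSupport L ω).subtype.baseChange k) := by
  classical
  let b := Module.finBasis L k
  let β := Algebra.TensorProduct.basis k b
  set ω' := TensorProduct.comm L k k ω with hω'
  set c : Fin (Module.finrank L k) → k := fun i => β.repr ω' i with hc
  -- `ω = Σ_i b_i ⊗ c_i` with `c_i` the `β`-coordinates of `comm ω`
  have hexp : ω = ∑ i, b i ⊗ₜ[L] c i := by
    have h1 : (∑ i, c i • β i) = ω' := β.sum_repr ω'
    have h2 : ω = (TensorProduct.comm L k k).symm ω' := by rw [hω', LinearEquiv.symm_apply_apply]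
    rw [h2, ← h1, map_sum]
    refine Finset.sum_congr rfl fun i _ => ?_
    rw [Algebra.TensorProduct.basis_apply, TensorProduct.smul_tmul', smul_eq_mul, mul_one,
      TensorProduct.comm_symm_tmul]
  -- each `c_i` is the contraction against the `i`-th coordinate functional
  have hz : ∀ i, c i ∈ rightSupport L ω := by
    intro i
    refine Submodule.subset_span ⟨b.coord i, ?_⟩
    show TensorProduct.lid L k ((b.coord i).rTensor k ω) = c i
    rw [hexp, map_sum, map_sum, Finset.sum_eq_single i]
    · rw [LinearMap.rTensor_tmul, TensorProduct.lid_tmul, Module.Basis.coord_apply, Module.Basis.repr_self,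
        Finsupp.single_eq_same, one_smul]
    · intro j _ hji
      rw [LinearMap.rTensor_tmul, TensorProduct.lid_tmul, Module.Basis.coord_apply, Module.Basis.repr_self,
        Finsupp.single_eq_of_ne hji.symm, zero_smul]
    · intro h; exact absurd (Finset.mem_univ i) h
  have key : (∑ i, b i ⊗ₜ[L] c i) ∈ LinearMap.range ((rightSupport L ω).subtype.baseChange k) := by
    refine Submodule.sum_mem _ fun i _ => ⟨b i ⊗ₜ ⟨c i, hz i⟩, ?_⟩
    rw [LinearMap.baseChange_tmul, Submodule.subtype_apply]
  rwa [← hexp] at key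

end Rank

/-! ## Lemma 1.5 -/

section Lemma15

variable {L : Type*} {k : Type*} [Field L] [Field k] [Algebra L k] {s : ℕ}

/-- `E_T f` has no constant term when every monomial of `f` has degree `> |T|`. [folklore] -/
theorem coeff_zero_opE_eq_zero (D : (Fin s →₀ ℕ) → k →+ k) (T : Fin s →₀ ℕ) (f : MvPolynomial (Fin s) k)
    (h : ∀ M ∈ f.support, T.degree < M.degree) : coeff 0 (opE D T f) = 0 := by
  rw [coeff_opE]
  refine Finset.sum_eq_zero fun M hM => Finset.sum_eq_zero fun x hx => ?_
  split_ifs with h0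
  · by_cases hmc : mchoose M x.2 = 0
    · rw [hmc, Nat.cast_zero, zero_mul]
    · exfalso
      have hle : x.2 ≤ M := by by_contra hn; exact hmc (mchoose_eq_zero_of_not_le hn)
      have hMx : M = x.2 := le_antisymm (tsub_eq_zero_iff_le.mp h0) hle
      have hxT : x.2 ≤ T := by
        rw [Finset.HasAntidiagonal.mem_antidiagonal] at hx
        rw [← hx]; exact le_add_self
      have h1 : M.degree ≤ T.degree := by
        have := map_add Finsupp.degree x.2 (T - x.2)
        rw [add_tsub_cancel_of_le hxT] at this
        rw [hMx]; omega
      exact absurd (h M hM) (not_lt.mpr h1)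
  · rfl

variable [FiniteDimensional L k]

/-- **LEMMA 1.5** (MIZUTANI-PROOF-g59 §1.4, abstract form): let `Ω : k ⊗_L k → k[X]` be `k`-linear,
intertwine `D_T ⊗ 1` with the profile operators `E_T`, and have the multiplication map as constant
coefficient.  If `ω ≠ 0` and all monomials of `Ω ω` have degree `≥ q`, then `σ_{q−1}(Ω ω) + 1 ≤ rank(ω)`.
Proof: `V = span_k{(D_T ⊗ 1)ω : |T| ≤ q−1} ⊆ (k ⊗ H_R(ω)) ∩ ker μ ⊊ k ⊗ H_R(ω)`, of `k`-dimension `rank ω`, and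
`Ω(V)` is the profile span. [cite: Mizutani1973HironakaGroupSchemes, Remark 2.10 (in-house proof §1.4, Lemma 1.5)] -/
theorem eProfile_succ_le_tensorRank (D : (Fin s →₀ ℕ) → k →ₗ[L] k)
    (Ω : k ⊗[L] k →ₗ[k] MvPolynomial (Fin s) k)
    (hΩD : ∀ (T : Fin s →₀ ℕ) (ω : k ⊗[L] k), Ω (TensorProduct.map (D T) LinearMap.id ω) =
      opE (fun T => (D T).toAddMonoidHom) T (Ω ω))
    (hΩμ : ∀ ω : k ⊗[L] k, coeff 0 (Ω ω) = Algebra.TensorProduct.lmul'' L (S := k) ω)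
    {q : ℕ} (hq : 1 ≤ q) (ω : k ⊗[L] k) (hω : ω ≠ 0) (hdeg : ∀ M ∈ (Ω ω).support, q ≤ M.degree) :
    eProfile (fun T => (D T).toAddMonoidHom) (q - 1) (Ω ω) + 1 ≤ tensorRank L ω := by
  classical
  set H := rightSupport L ω with hH
  set ι := H.subtype.baseChange k with hι
  set KH : Submodule k (k ⊗[L] k) := LinearMap.range ι with hKH
  set μ : k ⊗[L] k →ₗ[k] k := (Algebra.TensorProduct.lmul'' L (S := k)).toLinearMap with hμ
  set V : Submodule k (k ⊗[L] k) :=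
    Submodule.span k ((fun T => TensorProduct.map (D T) LinearMap.id ω) '' (degLE (Fin s) (q - 1) : Set _))
    with hV
  have hωKH : ω ∈ KH := mem_range_baseChange_rightSupport ω
  -- (i) `V ≤ KH`
  have hstab : ∀ (T : Fin s →₀ ℕ) (ξ : k ⊗[L] H), TensorProduct.map (D T) LinearMap.id (ι ξ) ∈ KH := by
    intro T ξ
    induction ξ using TensorProduct.induction_on with
    | zero => simp
    | tmul x h =>
      refine ⟨D T x ⊗ₜ h, ?_⟩
      rw [hι, LinearMap.baseChange_tmul, LinearMap.baseChange_tmul, TensorProduct.map_tmul]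
      rfl
    | add x y hx hy => rw [map_add, map_add]; exact KH.add_mem hx hy
  have hVKH : V ≤ KH := by
    rw [hV, Submodule.span_le]
    rintro _ ⟨T, -, rfl⟩
    obtain ⟨ξ, hξ⟩ := hωKH
    rw [← hξ]
    exact hstab T ξ
  -- (ii) `V ≤ ker μ`
  have hVμ : V ≤ LinearMap.ker μ := by
    rw [hV, Submodule.span_le]
    rintro _ ⟨T, hT, rfl⟩
    rw [SetLike.mem_coe, LinearMap.mem_ker, hμ, AlgHom.toLinearMap_apply, ← hΩμ, hΩD]
    refine coeff_zero_opE_eq_zero _ T _ fun M hM => ?_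
    have := hdeg M hM
    have := mem_degLE.mp (Finset.mem_coe.mp hT)
    omega
  -- (iii) an element of `KH` with `μ ≠ 0`
  have hHne : H ≠ ⊥ := by
    intro hbot
    apply hω
    obtain ⟨ξ, hξ⟩ := hωKH
    have hsub : H.subtype = 0 := by
      ext x
      exact (Submodule.eq_bot_iff H).mp hbot x x.2
    rw [← hξ, hι, hsub, LinearMap.baseChange_zero, LinearMap.zero_apply]
  obtain ⟨h, hhH, hh0⟩ := (Submodule.ne_bot_iff H).mp hHne
  have hx : ι (h⁻¹ ⊗ₜ ⟨h, hhH⟩) ∉ LinearMap.ker μ := by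
    rw [LinearMap.mem_ker, hι, LinearMap.baseChange_tmul, Submodule.subtype_apply, hμ,
      AlgHom.toLinearMap_apply]
    show Algebra.TensorProduct.lmul'' L (S := k) (h⁻¹ ⊗ₜ[L] h) ≠ 0
    rw [show Algebra.TensorProduct.lmul'' L (S := k) (h⁻¹ ⊗ₜ[L] h) = h⁻¹ * h from rfl, inv_mul_cancel₀ hh0]
    exact one_ne_zero
  have hlt : V < KH := by
    refine lt_of_le_of_lt (le_inf hVKH hVμ) (lt_of_le_of_ne inf_le_left fun heq => hx ?_)
    have : ι (h⁻¹ ⊗ₜ ⟨h, hhH⟩) ∈ KH ⊓ LinearMap.ker μ := by rw [heq]; exact ⟨_, rfl⟩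
    exact this.2
  -- (iv) dimensions
  have h1 : Module.finrank k V < Module.finrank k KH := Submodule.finrank_lt_finrank_of_lt hlt
  have h2 : Module.finrank k KH ≤ tensorRank L ω := by
    calc Module.finrank k KH ≤ Module.finrank k (k ⊗[L] H) := LinearMap.finrank_range_le ι
      _ = Module.finrank L H := Module.finrank_baseChange
      _ = tensorRank L ω := rfl
  -- (v) the profile span is `Ω(V)`
  have h3 : eProfile (fun T => (D T).toAddMonoidHom) (q - 1) (Ω ω) ≤ Module.finrank k V := by
    have hle : eSpan (fun T => (D T).toAddMonoidHom) (q - 1) (Ω ω) ≤ V.map Ω := by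
      unfold eSpan
      rw [Submodule.span_le]
      rintro _ ⟨T, hT, rfl⟩
      refine ⟨TensorProduct.map (D T) LinearMap.id ω, ?_, (hΩD T ω)⟩
      exact Submodule.subset_span ⟨T, hT, rfl⟩
    unfold eProfile
    haveI : Module.Finite k V := inferInstance
    exact (Submodule.finrank_mono hle).trans (Submodule.finrank_map_le Ω V)
  omega

end Lemma15

/-! ## Theorem F, abstract form: rank ≥ 2q -/

section TheoremF

variable (L k : Type*) [Field L] [Field k] [Algebra L k] (p e s : ℕ)

/-- **The data a tower supplies to the profile machinery** (MIZUTANI-PROOF-g59 §1.2–§1.4): `L`-linear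
operators `D_T` on `k` with `D_0 = id` (the Hasse–Schmidt operators of a `p`-basis) and a `k`-linear
coordinate map `Ω : k ⊗_L k → k[X_1..X_s]` (left `t`-coordinates, `t_i = a_i ⊗ 1 − 1 ⊗ a_i`) landing in
the box, intertwining `D_T ⊗ 1` with `E_T`, with the multiplication map as constant coefficient.
[cite: Oda1983HironakaGroupSchemeII, §1 (p. 1166: R = k ⊗_L k with its left k-basis (δa)^λ and the operators Δ)] -/
structure TowerBridge where
  /-- the Hasse–Schmidt operators `D^{(T)}` of the tower -/
  D : (Fin s →₀ ℕ) → k →ₗ[L] k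
  /-- the left `t`-coordinate map of `k ⊗_L k` -/
  Ω : k ⊗[L] k →ₗ[k] MvPolynomial (Fin s) k
  /-- `D^{(0)} = id` -/
  D_zero : D 0 = LinearMap.id
  /-- `Ω ∘ (D^{(T)} ⊗ 1) = E_T ∘ Ω` -/
  Ω_map : ∀ (T : Fin s →₀ ℕ) (ω : k ⊗[L] k),
    Ω (TensorProduct.map (D T) LinearMap.id ω) = opE (fun T => (D T).toAddMonoidHom) T (Ω ω)
  /-- the constant coefficient of `Ω` is the multiplication map `μ` -/
  Ω_coeff_zero : ∀ ω : k ⊗[L] k, coeff 0 (Ω ω) = Algebra.TensorProduct.lmul'' L (S := k) ω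
  /-- `Ω` lands in the box `[0, p^e − 1]^s` -/
  Ω_box : ∀ (ω : k ⊗[L] k), ∀ M ∈ (Ω ω).support, InBox (p ^ e) M

variable {L k p e s}

/-- **THEOREM F, rank form (abstract over the tower bridge)** — MIZUTANI-PROOF-g59 §2/§9: in a tower with `s ≥ 2`
directions over an infinite ground field of characteristic `p`, every GENUINE `ω` (its left `t`-coordinates
involve only monomials of degree `≥ q = p^e` and at least one genuine monomial, i.e. `ω ∈ J^q ∖ I_S`) has tensor
rank `≥ 2q`.  Proof: `profile_theorem` (`σ_{q−1} ≥ 2q − 1`) and Lemma 1.5 (`rank ≥ σ_{q−1} + 1`).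
[cite: Mizutani1973HironakaGroupSchemes, Remark 2.10 (in-house proof §2 / §9, THEOREM F)] -/
theorem theoremF_rank [Fact p.Prime] [CharP k p] [Infinite L] [FiniteDimensional L k]
    (B : TowerBridge L k p e s) (hs : 2 ≤ s) (he : 1 ≤ e) (ω : k ⊗[L] k)
    (hdeg : ∀ M ∈ (B.Ω ω).support, p ^ e ≤ M.degree) (hgen : ∃ M ∈ (B.Ω ω).support, IsGenuine p e M) :
    2 * p ^ e ≤ tensorRank L ω := by
  have hp : 0 < p := (Fact.out : p.Prime).pos
  have hq : 1 ≤ p ^ e := Nat.one_le_pow _ _ hp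
  -- the operator family is admissible for the constants `L ⊆ k`
  have hgood : GoodOps (algebraMap L k).range (fun T => (B.D T).toAddMonoidHom) := by
    refine ⟨?_, ?_⟩
    · ext x
      simp [B.D_zero]
    · rintro c ⟨l, rfl⟩ T x
      show B.D T (algebraMap L k l * x) = algebraMap L k l * B.D T x
      rw [← Algebra.smul_def, ← Algebra.smul_def, LinearMap.map_smul]
  have hinf : ((algebraMap L k).range : Set k).Infinite := by
    have : ((algebraMap L k).range : Set k) = Set.range (algebraMap L k) := rfl
    rw [this]
    exact Set.infinite_range_of_injective (algebraMap L k).injective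
  have hω : ω ≠ 0 := by
    obtain ⟨M, hM, -⟩ := hgen
    rintro rfl
    rw [map_zero, support_zero] at hM
    exact absurd hM (Finset.notMem_empty M)
  have hadm : ∀ M ∈ (B.Ω ω).support, InBox (p ^ e) M ∧ p ^ e ≤ M.degree :=
    fun M hM => ⟨B.Ω_box ω M hM, hdeg M hM⟩
  have h1 := profile_theorem (p := p) (e := e) (algebraMap L k).range hinf he s hs
    (fun T => (B.D T).toAddMonoidHom) (B.Ω ω) hgood hadm hgen (p ^ e - 1) (by omega)
  have h2 := eProfile_succ_le_tensorRank B.D B.Ω B.Ω_map B.Ω_coeff_zero hq ω hω hdeg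
  omega

end TheoremF

end Summit.ResolutionOfSingularities.KangarooAtlas.Mizutani
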